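import Mathlib
import HarnessLib

/-!
# Real-variable bookkeeping for the dispersion estimate in boxes

Topic `Literature/NumberTheory/Sieve`.  Three elementary inequalities between real quantities that occur
when the output of Linnik's dispersion method on one dyadic scale (main term + error term) is converted into
the four standard terms `(log x)⁴ (x/M) W^{1/2}`, `(x/M) W (log x)^{-A}`, `x^δ (x/M)^{1/2} W`,
`x^δ (x^{1+θ}/P)^{1/2} P^{3/2}` (Bombieri–Friedlander–Iwaniec 1986, §§3–6; the shapes are those of a
`k = 2` linear divisor problem with Möbius weights).  No number theory is involved.
-/

noncomputable section

open Real

namespace Literature.NumberTheory.Sieve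

namespace DispersionBox

/-- **The error term of one scale.**  With `T = C_τ ξ`, `1 ≤ U₁ ≤ x`, `U₁ ≤ P`, `1 ≤ Q ≤ Q₀`, `1 ≤ R ≤ x²`,
`0 ≤ Y ≤ W`, `1 ≤ W`:
`K T⁴ (1 + log 2U₁QR)³ ((Q(Y+1))² + U₁³) ≤ K C_τ⁴ ξ⁴ (3 + log 2Q₀)³ (1 + log x)³ (4Q₀²W² + P³)`. [folklore] -/
theorem err_term_le {K Cτ ξ U₁ Q R Q₀ x W P Y : ℝ} (hK : 0 ≤ K)
    (hU₁ : 1 ≤ U₁) (hU₁x : U₁ ≤ x) (hU₁P : U₁ ≤ P) (hQ : 1 ≤ Q) (hQQ₀ : Q ≤ Q₀) (hR : 1 ≤ R)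
    (hRx : R ≤ x ^ 2) (hY0 : 0 ≤ Y) (hYW : Y ≤ W) (hW : 1 ≤ W) (hx : 1 ≤ x) :
    K * (Cτ * ξ) ^ 4 * (1 + Real.log (2 * U₁ * Q * R)) ^ 3 * ((Q * (Y + 1)) ^ 2 + U₁ ^ 3) ≤
      K * Cτ ^ 4 * ξ ^ 4 * (3 + Real.log (2 * Q₀)) ^ 3 * (1 + Real.log x) ^ 3 *
        (4 * Q₀ ^ 2 * W ^ 2 + P ^ 3) := by
  have hQ₀ : 1 ≤ Q₀ := hQ.trans hQQ₀
  have hlogx : 0 ≤ Real.log x := Real.log_nonneg hx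
  have hlog2Q₀ : 0 ≤ Real.log (2 * Q₀) := Real.log_nonneg (by linarith)
  have harg1 : (1 : ℝ) ≤ U₁ * Q * R := one_le_mul_of_one_le_of_one_le (one_le_mul_of_one_le_of_one_le hU₁ hQ) hR
  have harg : (1 : ℝ) < 2 * U₁ * Q * R := by linarith
  have hℓ0 : 0 ≤ 1 + Real.log (2 * U₁ * Q * R) := by
    have := Real.log_nonneg harg.le; linarith
  have hℓ : 1 + Real.log (2 * U₁ * Q * R) ≤ (3 + Real.log (2 * Q₀)) * (1 + Real.log x) := by
    have h1 : 2 * U₁ * Q * R ≤ 2 * Q₀ * x ^ 3 := by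
      have hx0 : 0 ≤ x := by linarith
      calc 2 * U₁ * Q * R = 2 * (U₁ * Q * R) := by ring
        _ ≤ 2 * (x * Q₀ * x ^ 2) := by
            apply mul_le_mul_of_nonneg_left _ (by norm_num)
            exact mul_le_mul (mul_le_mul hU₁x hQQ₀ (by linarith) hx0) hRx (by linarith) (by positivity)
        _ = 2 * Q₀ * x ^ 3 := by ring
    have e3 : Real.log (2 * Q₀ * x ^ 3) = Real.log (2 * Q₀) + 3 * Real.log x := by
      rw [Real.log_mul (by positivity) (by positivity), Real.log_pow]; push_cast; ring
    have h2 : Real.log (2 * U₁ * Q * R) ≤ Real.log (2 * Q₀) + 3 * Real.log x := by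
      rw [← e3]; exact Real.log_le_log (by linarith) h1
    have h3 := mul_nonneg hlog2Q₀ hlogx
    nlinarith
  have hQY : (Q * (Y + 1)) ^ 2 ≤ 4 * Q₀ ^ 2 * W ^ 2 := by
    have h1 : Q * (Y + 1) ≤ Q₀ * (2 * W) :=
      mul_le_mul hQQ₀ (by linarith) (by linarith) (by linarith)
    have h0 : 0 ≤ Q * (Y + 1) := by positivity
    calc (Q * (Y + 1)) ^ 2 ≤ (Q₀ * (2 * W)) ^ 2 := pow_le_pow_left₀ h0 h1 2
      _ = 4 * Q₀ ^ 2 * W ^ 2 := by ring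
  have hU₁3 : U₁ ^ 3 ≤ P ^ 3 := pow_le_pow_left₀ (by linarith) hU₁P 3
  have hW0 : 0 ≤ W := by linarith
  have hP0 : 0 ≤ P := by linarith
  calc K * (Cτ * ξ) ^ 4 * (1 + Real.log (2 * U₁ * Q * R)) ^ 3 * ((Q * (Y + 1)) ^ 2 + U₁ ^ 3)
      ≤ K * (Cτ * ξ) ^ 4 * ((3 + Real.log (2 * Q₀)) * (1 + Real.log x)) ^ 3 *
          (4 * Q₀ ^ 2 * W ^ 2 + P ^ 3) := by
        apply mul_le_mul _ (add_le_add hQY hU₁3) (by positivity) (by positivity)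
        exact mul_le_mul_of_nonneg_left (pow_le_pow_left₀ hℓ0 hℓ 3) (by positivity)
    _ = _ := by ring

/-- **Combining main term and error term of one scale.** [folklore] -/
theorem scale_combine {S Lt R M E L₀ W D cL Q₀ K Cτ ξ cℓ P : ℝ}
    (h1 : S ≤ Lt ^ 2 * (2 * R * M + E)) (hM : M ≤ 4 * L₀ * W + 4 * Q₀ * L₀ * W ^ 2 * D)
    (hE : E ≤ K * Cτ ^ 4 * ξ ^ 4 * cℓ ^ 3 * L₀ ^ 3 * (4 * Q₀ ^ 2 * W ^ 2 + P ^ 3))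
    (hS0 : 0 ≤ S) (hLt0 : 0 < Lt) (hLt : Lt ≤ cL * L₀) (hR : 0 ≤ R) :
    S ≤ (8 * cL ^ 2) * L₀ ^ 3 * R * W + (8 * Q₀ * cL ^ 2) * L₀ ^ 3 * R * W ^ 2 * D +
      (4 * Q₀ ^ 2 * cL ^ 2 * K * Cτ ^ 4 * cℓ ^ 3) * L₀ ^ 5 * ξ ^ 4 * W ^ 2 +
      (cL ^ 2 * K * Cτ ^ 4 * cℓ ^ 3) * L₀ ^ 5 * ξ ^ 4 * P ^ 3 := by
  have hv : 0 ≤ 2 * R * M + E := by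
    refine le_of_not_gt fun h => ?_
    have : Lt ^ 2 * (2 * R * M + E) < 0 := mul_neg_of_pos_of_neg (by positivity) h
    linarith
  have hLt2 : Lt ^ 2 ≤ (cL * L₀) ^ 2 := pow_le_pow_left₀ hLt0.le hLt 2
  calc S ≤ Lt ^ 2 * (2 * R * M + E) := h1
    _ ≤ (cL * L₀) ^ 2 * (2 * R * (4 * L₀ * W + 4 * Q₀ * L₀ * W ^ 2 * D) +
          K * Cτ ^ 4 * ξ ^ 4 * cℓ ^ 3 * L₀ ^ 3 * (4 * Q₀ ^ 2 * W ^ 2 + P ^ 3)) :=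
        mul_le_mul hLt2 (add_le_add (mul_le_mul_of_nonneg_left hM (by positivity)) hE) hv
          (by positivity)
    _ = _ := by ring

/-- **Collecting the four terms.**  With `L₀ = 1 + L`, `ρ₁ = c_q X/M`, `ρ₂ = X^{1+θ}/P`, `L₀⁵ ≤ ξ`, `ξ³ = X^δ`,
`D = L₀^{−(2A+8)}`, the sum over the `≤ 3L₀` dyadic scales of the four scale terms is bounded by
`3c_q Σᵢ(4cᵢ+1)` times the four target terms. [folklore] -/
theorem final_collect {Lx ξ X M W P cq D A δ θ c1 c2 c3 c4 : ℝ}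
    (hLx : 0 ≤ Lx) (hX : 0 < X) (hM : 0 < M) (hW : 0 ≤ W) (hP : 0 < P) (hcq : 1 ≤ cq)
    (hc1 : 0 ≤ c1) (hc2 : 0 ≤ c2) (hc3 : 0 ≤ c3) (hc4 : 0 ≤ c4)
    (hL₀ξ : (1 + Lx) ^ 5 ≤ ξ) (hξ3 : ξ ^ 3 = X ^ δ) (hD : D = (1 + Lx) ^ (-(2 * A + 8))) :
    3 * (1 + Lx) * ((4 * c1 + 1) * (1 + Lx) ^ 3 * (cq * X / M) * Real.sqrt W +
        (4 * c2 + 1) * (1 + Lx) ^ 3 * (cq * X / M) * W * Real.sqrt D +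
        (4 * c3 + 1) * (1 + Lx) ^ 4 * ξ ^ 2 * Real.sqrt (cq * X / M) * W +
        (4 * c4 + 1) * (1 + Lx) ^ 4 * ξ ^ 2 * Real.sqrt (X ^ (1 + θ) / P) * P * Real.sqrt P) ≤
      3 * cq * ((4 * c1 + 1) + (4 * c2 + 1) + (4 * c3 + 1) + (4 * c4 + 1)) *
        ((1 + Lx) ^ 4 * (X / M) * W ^ (1 / 2 : ℝ) + (X / M) * W / (1 + Lx) ^ A +
          X ^ δ * (X / M) ^ (1 / 2 : ℝ) * W + X ^ δ * (X ^ (1 + θ) / P) ^ (1 / 2 : ℝ) * P ^ (3 / 2 : ℝ)) := by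
  set L₀ : ℝ := 1 + Lx with hL₀
  set K : ℝ := 3 * cq * ((4 * c1 + 1) + (4 * c2 + 1) + (4 * c3 + 1) + (4 * c4 + 1)) with hK
  have hL₀pos : 0 < L₀ := by rw [hL₀]; linarith
  have hL₀1 : 1 ≤ L₀ := by rw [hL₀]; linarith
  have hξ0 : 0 ≤ ξ := le_trans (by positivity) hL₀ξ
  have hD0 : 0 ≤ D := by rw [hD]; exact Real.rpow_nonneg hL₀pos.le _
  have hρ₂0 : 0 ≤ X ^ (1 + θ) / P := by
    have := Real.rpow_nonneg hX.le (1 + θ); positivity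
  -- nonnegativity of the four target terms
  have hT1_0 : 0 ≤ L₀ ^ 4 * (X / M) * W ^ (1 / 2 : ℝ) := by
    have := Real.rpow_nonneg hW (1 / 2 : ℝ); positivity
  have hT2_0 : 0 ≤ (X / M) * W / L₀ ^ A := by
    have := Real.rpow_nonneg hL₀pos.le A; positivity
  have hT3_0 : 0 ≤ X ^ δ * (X / M) ^ (1 / 2 : ℝ) * W := by
    have := Real.rpow_nonneg hX.le δ
    have := Real.rpow_nonneg (show (0 : ℝ) ≤ X / M by positivity) (1 / 2 : ℝ)
    positivity
  have hT4_0 : 0 ≤ X ^ δ * (X ^ (1 + θ) / P) ^ (1 / 2 : ℝ) * P ^ (3 / 2 : ℝ) := by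
    have := Real.rpow_nonneg hX.le δ
    have := Real.rpow_nonneg hρ₂0 (1 / 2 : ℝ)
    have := Real.rpow_nonneg hP.le (3 / 2 : ℝ)
    positivity
  -- conversions between `√` and real powers
  have hsqW : Real.sqrt W = W ^ (1 / 2 : ℝ) := Real.sqrt_eq_rpow W
  have hsqρ₂ : Real.sqrt (X ^ (1 + θ) / P) = (X ^ (1 + θ) / P) ^ (1 / 2 : ℝ) := Real.sqrt_eq_rpow _
  have hsqxM : Real.sqrt (X / M) = (X / M) ^ (1 / 2 : ℝ) := Real.sqrt_eq_rpow _
  have hP32 : P * Real.sqrt P = P ^ (3 / 2 : ℝ) := by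
    rw [Real.sqrt_eq_rpow, show (3 / 2 : ℝ) = 1 + 1 / 2 by norm_num, Real.rpow_add hP, Real.rpow_one]
  have hsqρ₁ : Real.sqrt (cq * X / M) ≤ cq * Real.sqrt (X / M) := by
    rw [mul_div_assoc, Real.sqrt_mul (by linarith)]
    apply mul_le_mul_of_nonneg_right _ (Real.sqrt_nonneg _)
    rw [Real.sqrt_le_left (by linarith)]; exact le_self_pow₀ hcq (by norm_num)
  have hsd : L₀ ^ 4 * Real.sqrt D = (L₀ ^ A)⁻¹ := by
    rw [hD, Real.sqrt_eq_rpow, ← Real.rpow_mul hL₀pos.le, ← Real.rpow_neg hL₀pos.le,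
      show L₀ ^ 4 = L₀ ^ (4 : ℝ) by exact_mod_cast (Real.rpow_natCast L₀ 4).symm,
      ← Real.rpow_add hL₀pos]
    congr 1; ring
  -- term by term
  have e1 : 3 * L₀ * ((4 * c1 + 1) * L₀ ^ 3 * (cq * X / M) * Real.sqrt W) =
      3 * cq * (4 * c1 + 1) * (L₀ ^ 4 * (X / M) * W ^ (1 / 2 : ℝ)) := by
    rw [hsqW]; ring
  have e2 : 3 * L₀ * ((4 * c2 + 1) * L₀ ^ 3 * (cq * X / M) * W * Real.sqrt D) =
      3 * cq * (4 * c2 + 1) * ((X / M) * W / L₀ ^ A) := by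
    have : 3 * L₀ * ((4 * c2 + 1) * L₀ ^ 3 * (cq * X / M) * W * Real.sqrt D) =
        3 * (4 * c2 + 1) * (cq * X / M) * W * (L₀ ^ 4 * Real.sqrt D) := by ring
    rw [this, hsd]; ring
  have e3 : 3 * L₀ * ((4 * c3 + 1) * L₀ ^ 4 * ξ ^ 2 * Real.sqrt (cq * X / M) * W) ≤
      3 * cq * (4 * c3 + 1) * (X ^ δ * (X / M) ^ (1 / 2 : ℝ) * W) := by
    rw [← hsqxM, ← hξ3]
    have h1 : L₀ ^ 5 * Real.sqrt (cq * X / M) ≤ ξ * (cq * Real.sqrt (X / M)) :=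
      mul_le_mul hL₀ξ hsqρ₁ (Real.sqrt_nonneg _) hξ0
    have h2 : 0 ≤ 3 * (4 * c3 + 1) * ξ ^ 2 * W := by positivity
    calc 3 * L₀ * ((4 * c3 + 1) * L₀ ^ 4 * ξ ^ 2 * Real.sqrt (cq * X / M) * W)
        = 3 * (4 * c3 + 1) * ξ ^ 2 * W * (L₀ ^ 5 * Real.sqrt (cq * X / M)) := by ring
      _ ≤ 3 * (4 * c3 + 1) * ξ ^ 2 * W * (ξ * (cq * Real.sqrt (X / M))) :=
          mul_le_mul_of_nonneg_left h1 h2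
      _ = 3 * cq * (4 * c3 + 1) * (ξ ^ 3 * Real.sqrt (X / M) * W) := by ring
  have e4 : 3 * L₀ * ((4 * c4 + 1) * L₀ ^ 4 * ξ ^ 2 * Real.sqrt (X ^ (1 + θ) / P) * P * Real.sqrt P) ≤
      3 * cq * (4 * c4 + 1) * (X ^ δ * (X ^ (1 + θ) / P) ^ (1 / 2 : ℝ) * P ^ (3 / 2 : ℝ)) := by
    rw [← hsqρ₂, ← hξ3, ← hP32]
    have h2 : 0 ≤ 3 * (4 * c4 + 1) * ξ ^ 2 * Real.sqrt (X ^ (1 + θ) / P) * P * Real.sqrt P := by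
      positivity
    calc 3 * L₀ * ((4 * c4 + 1) * L₀ ^ 4 * ξ ^ 2 * Real.sqrt (X ^ (1 + θ) / P) * P * Real.sqrt P)
        = 3 * (4 * c4 + 1) * ξ ^ 2 * Real.sqrt (X ^ (1 + θ) / P) * P * Real.sqrt P * L₀ ^ 5 := by ring
      _ ≤ 3 * (4 * c4 + 1) * ξ ^ 2 * Real.sqrt (X ^ (1 + θ) / P) * P * Real.sqrt P * ξ :=
          mul_le_mul_of_nonneg_left hL₀ξ h2
      _ = 1 * (3 * (4 * c4 + 1) * (ξ ^ 3 * Real.sqrt (X ^ (1 + θ) / P) * (P * Real.sqrt P))) := by ring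
      _ ≤ cq * (3 * (4 * c4 + 1) * (ξ ^ 3 * Real.sqrt (X ^ (1 + θ) / P) * (P * Real.sqrt P))) :=
          mul_le_mul_of_nonneg_right hcq (by positivity)
      _ = _ := by ring
  -- collect
  have h3cq : 0 ≤ 3 * cq := by linarith
  have hK1 : 3 * cq * (4 * c1 + 1) ≤ K := mul_le_mul_of_nonneg_left (by linarith) h3cq
  have hK2 : 3 * cq * (4 * c2 + 1) ≤ K := mul_le_mul_of_nonneg_left (by linarith) h3cq
  have hK3 : 3 * cq * (4 * c3 + 1) ≤ K := mul_le_mul_of_nonneg_left (by linarith) h3cq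
  have hK4 : 3 * cq * (4 * c4 + 1) ≤ K := mul_le_mul_of_nonneg_left (by linarith) h3cq
  calc 3 * L₀ * ((4 * c1 + 1) * L₀ ^ 3 * (cq * X / M) * Real.sqrt W +
        (4 * c2 + 1) * L₀ ^ 3 * (cq * X / M) * W * Real.sqrt D +
        (4 * c3 + 1) * L₀ ^ 4 * ξ ^ 2 * Real.sqrt (cq * X / M) * W +
        (4 * c4 + 1) * L₀ ^ 4 * ξ ^ 2 * Real.sqrt (X ^ (1 + θ) / P) * P * Real.sqrt P)
      = 3 * L₀ * ((4 * c1 + 1) * L₀ ^ 3 * (cq * X / M) * Real.sqrt W) +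
        3 * L₀ * ((4 * c2 + 1) * L₀ ^ 3 * (cq * X / M) * W * Real.sqrt D) +
        3 * L₀ * ((4 * c3 + 1) * L₀ ^ 4 * ξ ^ 2 * Real.sqrt (cq * X / M) * W) +
        3 * L₀ * ((4 * c4 + 1) * L₀ ^ 4 * ξ ^ 2 * Real.sqrt (X ^ (1 + θ) / P) * P * Real.sqrt P) := by
          ring
    _ ≤ K * (L₀ ^ 4 * (X / M) * W ^ (1 / 2 : ℝ)) + K * ((X / M) * W / L₀ ^ A) +
        K * (X ^ δ * (X / M) ^ (1 / 2 : ℝ) * W) +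
        K * (X ^ δ * (X ^ (1 + θ) / P) ^ (1 / 2 : ℝ) * P ^ (3 / 2 : ℝ)) := by
          rw [e1, e2]
          gcongr ?_ + ?_ + ?_ + ?_
          · exact mul_le_mul_of_nonneg_right hK1 hT1_0
          · exact mul_le_mul_of_nonneg_right hK2 hT2_0
          · exact e3.trans (mul_le_mul_of_nonneg_right hK3 hT3_0)
          · exact e4.trans (mul_le_mul_of_nonneg_right hK4 hT4_0)
    _ = _ := by ring

end DispersionBox

end Literature.NumberTheory.Sieve
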